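import Summits.QuantumFields.BalabanUV.T4Continuum.Support.SubtypeCompression
import Summits.QuantumFields.BalabanUV.T4Continuum.Support.ScalarPlantingDefect
import Summits.QuantumFields.BalabanUV.Beta.GAN24.DirichletBoxRegularity

/-!
# `BalabanUV.Beta.GAN24.DirichletBoxCompression` — binder row G-an2-4 / (CONV-C), road P2 PART II, module M-C: THE COMPRESSED
# (DIRICHLET) SCALAR OPERATORS `D^Ω = (Δ′)_{ΩΩ}`, their inverses, the zero-extended Dirichlet solutions and their energy bounds, and the
# compressed two-level DEFECT IDENTITY `G′^{Ω′}J^Ω − J^ΩG^Ω = G′^{Ω′}·(J₀Δ − Δ′J₀)_{Ω′Ω}·G^Ω` (unit b2b-balaban-gan24-p2, gen 22, v1)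

HONEST FRAMING (cell contract, verbatim): «discharging `BetaPertH` makes Bałaban's UV stability UNCONDITIONAL — a real constructive-QFT
result; it is NOT the continuum limit and NOT the Clay problem.»  SUPPLIER item «Δ1-BOX-SCALAR» under the T⁴-DAG sub-row
`T4-U1a.S-NE2-D1-DIRICHLET°` (holder: the t4-ne2-p1 lineage; OWNER RULING R20 (c), journal l.13903: «import `Support/SubtypeCompression`
… the TARGET SHAPE is the binder `hinj : ∀ k, ‖(D^Ω_{k+1})⁻¹·J^Ω_k − J^Ω_k·(D^Ω_k)⁻¹‖ ≤ e₁ k` for your scalar carriers … mind the compression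
convention `Ω₀Δ_aΩ₀` on ℓ²(Ω) (zero OUTSIDE, boundary = first exterior layer)»).  THIS FILE fixes exactly that convention for the
`U = 1` SCALAR layer ([Balaban1985BackgroundPropagators] (3.24) p. 394 «Δ′_a = Δ^η_U + Q′*aQ′ … the operator Δ′_a with Dirichlet boundary
conditions on ∂Ω₀, i.e. the operator Δ′_a↾Ω₀ = Ω₀Δ′_aΩ₀», at `U = 1`): `D^Ω := (DeltaPs n M a′).toBlock Ω Ω` on `ℓ²({x // Ω x})` — NO
reflection, NO modified stencil at the boundary — and supplies the compressed objects and bounds the Dirichlet two-level law (module M-E)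
is assembled from:

 * §1 ONE LEVEL: `DOm = (Δ′)_{ΩΩ}` is `γ′`-coercive (`ScalarAveragedPropagator.re_form_DeltaPs_ge` + `SubtypeCompression.coercive_toBlock`),
   hence invertible with **`opNorm_inv_DOm_le`** `‖(D^Ω)⁻¹‖ ≤ γ′⁻¹` for EVERY `Ω` (any decidable set of sites), Hermitian; the ZERO-EXTENDED
   DIRICHLET SOLUTION `solExt f = ext(G^Ω f)` vanishes off `Ω`, returns the datum on `Ω` (`DeltaPs_solExt_apply`), and obeys the ENERGY
   BOUNDS **`dirichlet_solExt_le`** `Σ_μ‖∂_μu‖² ≤ γ′⁻¹‖f‖²`, `‖u‖² ≤ γ′⁻²‖f‖²`, **`sum_normSq_LapS_solExt_le`** `Σ_{x∈Ω}|(Δu)(x)|² ≤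
   2(1 + (a′γ′⁻¹)²)‖f‖²` (on `Ω`, `Δu = f − a′Πu`).
 * §2 TWO LEVELS `(N, RN)`: the refined region `Ω′ = par⁻¹Ω`, the compressed planting `JOm = (J₀)_{Ω′Ω}`; King's planting never couples a
   fine site to a coarse site other than its parent, so compression is MULTIPLICATIVE (`toBlock_JK0_mul`, `toBlock_mul_JK0`, via
   `SubtypeCompression.toBlock_mul_of_vanish_*`); the mass terms intertwine EXACTLY (`ScalarPlantingDefect.PiS_mul_JK0`), so
   **`defect_eq`**: `(D′^{Ω′})⁻¹·J^Ω − J^Ω·(D^Ω)⁻¹ = (D′^{Ω′})⁻¹·(J₀·Δ_N − Δ_{RN}·J₀)_{Ω′Ω}·(D^Ω)⁻¹` and its pairing form **`form_defect`**: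
   `⟨w, ((D′^{Ω′})⁻¹J^Ω − J^Ω(D^Ω)⁻¹)f⟩ = ⟨solExt′ w, (J₀Δ_N − Δ_{RN}J₀)·solExt f⟩` — the torus pairing of module M-P on two zero-extended
   Dirichlet solutions.
 * §3 `opNorm_le_of_pairing`: an operator-norm bound from a bound on all pairings (for the END of module M-E).

ABSOLUTE RULE (cell, verbatim): «No internally-minted statement may enter as a cited fact. Every hypothesis is either kernel-proved in
this package or a verbatim quotation of a PUBLISHED theorem with page reference. The manuscript(s) under audit are NOT citable for
their own disputed steps — they are the thing under adjudication; programme-internal (2001/route/tribunal) claims are never citable.»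
[folklore] finite-dimensional linear algebra on the tree's typed objects; nothing printed is a hypothesis.  NOT CLAIMED: NE2, (CONV-C) as
a whole, `BetaPertH`, continuum, Clay; «not in print; our proof attempt».  HONEST DEPENDENCY: continuum YM on T⁴ ⇐ BetaPertH ∧ nine spine
estimates (0/9 proved); BetaPertH ⇐ (D1) ∧ (D4) ∧ CAP+tail; G-an2-4 gates asym, D1 and NE2/3/4.
-/

noncomputable section

open scoped BigOperators ComplexConjugate Matrix Matrix.Norms.L2Operator
open Finset

namespace Summit.QuantumFields.BalabanUV.Beta.GAN24.DirichletBoxCompression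

open Literature.MathematicalPhysics.QuantumFieldTheory.Balaban1983to89.B5Prop11Plancherel (Tor fine unitVec)
open Literature.MathematicalPhysics.QuantumFieldTheory.Balaban1983to89.B5Action121 (sdiff LapS star_mulVec_dotProduct
  dotProduct_mulVec_eq_star_conjTranspose_mulVec)
open Literature.MathematicalPhysics.QuantumFieldTheory.Balaban1983to89.B5Prop11Lower (nsq nsq_nonneg star_dotProduct_self
  norm_star_dotProduct_le nsq_mulVec_le)
open Summit.QuantumFields.BalabanUV.T4Continuum
open Summit.QuantumFields.BalabanUV.T4Continuum.BalabanAveragedTowerModes (par)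
open Summit.QuantumFields.BalabanUV.T4Continuum.ScalarBlockPoincare (PiS nsq_PiS_mulVec_le nsq_add_le nsq_smul)
open Summit.QuantumFields.BalabanUV.T4Continuum.ScalarAveragedPropagator (DeltaPs gammaPs dirichlet gammaPs_pos re_form_DeltaPs
  re_form_DeltaPs_ge dirichlet_nonneg DeltaPs_isHermitian re_star_dotProduct_le dirichlet_le_re_form nsq_sdiff_le_dirichlet
  opNorm_le_of_nsq_le_rect)
open Summit.QuantumFields.BalabanUV.T4Continuum.ScalarBlockPlanting (Qavg0 JK0 star_Qavg0_apply)
open Summit.QuantumFields.BalabanUV.T4Continuum.ScalarPlantingDefect (PiS_mul_JK0)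
open Summit.QuantumFields.BalabanUV.T4Continuum.SubtypeCompression (sel ext Coercive toBlock_mulVec form_toBlock ext_apply_of
  ext_apply_of_not nsq_ext star_ext_dotProduct coercive_toBlock isUnit_det_toBlock_of_coercive opNorm_inv_toBlock_le_of_coercive
  toBlock_mul_of_vanish_left toBlock_mul_of_vanish_right toBlock_sub toBlock_conjTranspose)

variable {d : ℕ}

/-! ## §1 One level: `D^Ω`, its inverse, the zero-extended Dirichlet solution and its energy bounds -/

section OneLevel

variable (n : ℕ) [NeZero n] (M : Fin d → ℕ) [hM : ∀ μ, NeZero (M μ)] (a' : ℝ) (Ω : Tor (fine n M) → Prop) [DecidablePred Ω]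

/-- **THE COMPRESSED SCALAR OPERATOR** `D^Ω = (Δ′)_{ΩΩ} = Ω₀Δ′_aΩ₀` at `U = 1` on `ℓ²(Ω)` (zero OUTSIDE `Ω`; the boundary is the first
exterior layer). [cite: Balaban1985BackgroundPropagators, (3.24)/(3.27) p.394-395] [folklore] -/
def DOm : Matrix {x // Ω x} {x // Ω x} ℂ := (DeltaPs n M a').toBlock Ω Ω

/-- `Δ′ = Δ + a′Π′` is `γ′`-coercive on the whole torus. [folklore] -/
theorem coercive_DeltaPs (ha' : 0 < a') : Coercive (DeltaPs n M a') (gammaPs d a') :=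
  fun v => re_form_DeltaPs_ge n M ha' v

/-- `D^Ω` is invertible … [folklore] -/
theorem isUnit_det_DOm (ha' : 0 < a') : IsUnit (DOm n M a' Ω).det :=
  isUnit_det_toBlock_of_coercive Ω (gammaPs_pos (d := d) (a' := a')).1 (coercive_DeltaPs n M a' ha')

/-- … with **`‖(D^Ω)⁻¹‖ ≤ γ′⁻¹`**, for EVERY region `Ω`, uniformly in `n` and the torus. [folklore] -/
theorem opNorm_inv_DOm_le (ha' : 0 < a') : ‖(DOm n M a' Ω)⁻¹‖ ≤ (gammaPs d a')⁻¹ :=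
  opNorm_inv_toBlock_le_of_coercive Ω (gammaPs_pos (d := d) (a' := a')).1 (coercive_DeltaPs n M a' ha')

omit [DecidablePred Ω] in
/-- `D^Ω` is Hermitian. [folklore] -/
theorem DOm_isHermitian : (DOm n M a' Ω).IsHermitian := by
  show (DOm n M a' Ω)ᴴ = DOm n M a' Ω
  rw [DOm, toBlock_conjTranspose, (DeltaPs_isHermitian n M a').eq]

/-- `(D^Ω)⁻¹` is Hermitian. [folklore] -/
theorem inv_DOm_isHermitian : ((DOm n M a' Ω)⁻¹).IsHermitian := (DOm_isHermitian n M a' Ω).inv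

/-- **THE ZERO-EXTENDED DIRICHLET SOLUTION** `u_f = ext(G^Ω f)`, `G^Ω = (D^Ω)⁻¹`. [folklore] -/
def solExt (f : {x // Ω x} → ℂ) : Tor (fine n M) → ℂ := ext Ω ((DOm n M a' Ω)⁻¹ *ᵥ f)

/-- `u_f` vanishes off `Ω`. [folklore] -/
theorem solExt_apply_of_not (f : {x // Ω x} → ℂ) {x : Tor (fine n M)} (hx : ¬ Ω x) : solExt n M a' Ω f x = 0 :=
  ext_apply_of_not Ω _ hx

/-- `u_f` on `Ω` is `G^Ω f`. [folklore] -/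
theorem solExt_apply_of (f : {x // Ω x} → ℂ) (a : {x // Ω x}) : solExt n M a' Ω f a = ((DOm n M a' Ω)⁻¹ *ᵥ f) a :=
  ext_apply_of Ω _ a

/-- `‖u_f‖² = ‖G^Ω f‖² ≤ γ′⁻²‖f‖²`. [folklore] -/
theorem nsq_solExt_le (ha' : 0 < a') (f : {x // Ω x} → ℂ) : nsq (solExt n M a' Ω f) ≤ ((gammaPs d a')⁻¹) ^ 2 * nsq f := by
  rw [solExt, nsq_ext]
  refine (nsq_mulVec_le _ f).trans (mul_le_mul_of_nonneg_right ?_ (nsq_nonneg f))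
  exact pow_le_pow_left₀ (norm_nonneg _) (opNorm_inv_DOm_le n M a' Ω ha') 2

/-- on `Ω`, `Δ′u_f = f`. [folklore] -/
theorem DeltaPs_solExt_apply (ha' : 0 < a') (f : {x // Ω x} → ℂ) (a : {x // Ω x}) :
    (DeltaPs n M a' *ᵥ solExt n M a' Ω f) a = f a := by
  have h := toBlock_mulVec Ω (DeltaPs n M a') ((DOm n M a' Ω)⁻¹ *ᵥ f)
  have h2 : (DeltaPs n M a').toBlock Ω Ω *ᵥ ((DOm n M a' Ω)⁻¹ *ᵥ f) = f := by
    rw [← DOm, Matrix.mulVec_mulVec, Matrix.mul_nonsing_inv _ (isUnit_det_DOm n M a' Ω ha'), Matrix.one_mulVec]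
  have h3 := congrFun h a
  rw [h2] at h3
  rw [solExt]
  exact h3.symm

/-- the energy identity `Re⟨u_f, Δ′u_f⟩ = Re⟨G^Ω f, f⟩`. [folklore] -/
theorem re_form_solExt (ha' : 0 < a') (f : {x // Ω x} → ℂ) :
    (star (solExt n M a' Ω f) ⬝ᵥ (DeltaPs n M a' *ᵥ solExt n M a' Ω f)).re = (star ((DOm n M a' Ω)⁻¹ *ᵥ f) ⬝ᵥ f).re := by
  have h2 : DOm n M a' Ω *ᵥ ((DOm n M a' Ω)⁻¹ *ᵥ f) = f := by
    rw [Matrix.mulVec_mulVec, Matrix.mul_nonsing_inv _ (isUnit_det_DOm n M a' Ω ha'), Matrix.one_mulVec]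
  rw [solExt, ← form_toBlock, ← DOm, h2]

/-- `Re⟨G^Ω f, f⟩ ≤ γ′⁻¹‖f‖²`. [folklore] -/
theorem re_inv_form_le (ha' : 0 < a') (f : {x // Ω x} → ℂ) :
    (star ((DOm n M a' Ω)⁻¹ *ᵥ f) ⬝ᵥ f).re ≤ (gammaPs d a')⁻¹ * nsq f := by
  have hγ := (gammaPs_pos (d := d) (a' := a')).1
  set g := (DOm n M a' Ω)⁻¹ *ᵥ f with hg
  have h1 : (star g ⬝ᵥ f).re ≤ Real.sqrt (nsq g) * Real.sqrt (nsq f) := re_star_dotProduct_le g f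
  have h2 : nsq g ≤ ((gammaPs d a')⁻¹) ^ 2 * nsq f :=
    (nsq_mulVec_le _ f).trans (mul_le_mul_of_nonneg_right (pow_le_pow_left₀ (norm_nonneg _) (opNorm_inv_DOm_le n M a' Ω ha') 2)
      (nsq_nonneg f))
  have h3 : Real.sqrt (nsq g) ≤ (gammaPs d a')⁻¹ * Real.sqrt (nsq f) := by
    calc Real.sqrt (nsq g) ≤ Real.sqrt (((gammaPs d a')⁻¹) ^ 2 * nsq f) := Real.sqrt_le_sqrt h2
      _ = (gammaPs d a')⁻¹ * Real.sqrt (nsq f) := by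
          rw [Real.sqrt_mul (sq_nonneg _), Real.sqrt_sq (inv_nonneg.mpr hγ.le)]
  have hsf : Real.sqrt (nsq f) * Real.sqrt (nsq f) = nsq f := Real.mul_self_sqrt (nsq_nonneg _)
  calc (star g ⬝ᵥ f).re ≤ Real.sqrt (nsq g) * Real.sqrt (nsq f) := h1
    _ ≤ (gammaPs d a')⁻¹ * Real.sqrt (nsq f) * Real.sqrt (nsq f) := mul_le_mul_of_nonneg_right h3 (Real.sqrt_nonneg _)
    _ = (gammaPs d a')⁻¹ * nsq f := by rw [mul_assoc, hsf]

/-- **ENERGY BOUND**: `Σ_μ ‖∂_μ u_f‖² ≤ γ′⁻¹‖f‖²`. [folklore] -/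
theorem dirichlet_solExt_le (ha' : 0 < a') (f : {x // Ω x} → ℂ) :
    dirichlet n M (solExt n M a' Ω f) ≤ (gammaPs d a')⁻¹ * nsq f :=
  ((dirichlet_le_re_form n M ha' _).trans (le_of_eq (re_form_solExt n M a' Ω ha' f))).trans (re_inv_form_le n M a' Ω ha' f)

/-- one direction: `‖∂_μ u_f‖² ≤ γ′⁻¹‖f‖²`. [folklore] -/
theorem nsq_sdiff_solExt_le (ha' : 0 < a') (f : {x // Ω x} → ℂ) (μ : Fin d) :
    nsq (sdiff (fine n M) (n : ℂ) μ *ᵥ solExt n M a' Ω f) ≤ (gammaPs d a')⁻¹ * nsq f :=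
  (nsq_sdiff_le_dirichlet n M μ _).trans (dirichlet_solExt_le n M a' Ω ha' f)

omit [DecidablePred Ω] in
/-- a sum over the sites of `Ω` is at most the sum over the torus (nonnegative terms). [folklore] -/
theorem sum_subtype_le_sum {F : Tor (fine n M) → ℝ} (hF : ∀ x, 0 ≤ F x) [DecidablePred Ω] :
    ∑ a : {x // Ω x}, F a ≤ ∑ x, F x := by
  rw [← Fintype.sum_subtype_add_sum_subtype Ω F]
  exact le_add_of_nonneg_right (Finset.sum_nonneg fun b _ => hF _)

/-- **SECOND-DIFFERENCE BUDGET**: on `Ω`, `Δu_f = f − a′Πu_f`, hence `Σ_{x∈Ω}|(Δu_f)(x)|² ≤ 2(1 + (a′γ′⁻¹)²)·‖f‖²`. [folklore] -/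
theorem sum_normSq_LapS_solExt_le (ha' : 0 < a') (f : {x // Ω x} → ℂ) :
    ∑ a : {x // Ω x}, ‖(LapS (fine n M) (n : ℂ) *ᵥ solExt n M a' Ω f) a‖ ^ 2
      ≤ 2 * (1 + (a' * (gammaPs d a')⁻¹) ^ 2) * nsq f := by
  have hγ := (gammaPs_pos (d := d) (a' := a')).1
  set u := solExt n M a' Ω f with hu
  -- on `Ω`: `Δu = f − a′Πu`
  have e : ∀ a : {x // Ω x}, (LapS (fine n M) (n : ℂ) *ᵥ u) a = f a - (a' : ℂ) * (PiS n M *ᵥ u) a := by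
    intro a
    have h := DeltaPs_solExt_apply n M a' Ω ha' f a
    rw [← hu, DeltaPs, Matrix.add_mulVec, Matrix.smul_mulVec, Pi.add_apply, Pi.smul_apply, smul_eq_mul] at h
    rw [← h]; ring
  have e2 : (fun a : {x // Ω x} => (LapS (fine n M) (n : ℂ) *ᵥ u) a)
      = f + (-(a' : ℂ)) • (fun a : {x // Ω x} => (PiS n M *ᵥ u) a) := by
    funext a; rw [e a]; simp; ring
  have hsum : ∑ a : {x // Ω x}, ‖(LapS (fine n M) (n : ℂ) *ᵥ u) a‖ ^ 2
      = nsq (f + (-(a' : ℂ)) • (fun a : {x // Ω x} => (PiS n M *ᵥ u) a)) := by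
    rw [← e2]; rfl
  rw [hsum]
  refine (nsq_add_le _ _).trans ?_
  rw [nsq_smul, norm_neg, Complex.norm_real, Real.norm_eq_abs, sq_abs]
  -- the restricted `Πu` has `nsq ≤ nsq (Πu) ≤ nsq u ≤ γ′⁻² nsq f`
  have hP : nsq (fun a : {x // Ω x} => (PiS n M *ᵥ u) a) ≤ ((gammaPs d a')⁻¹) ^ 2 * nsq f := by
    calc nsq (fun a : {x // Ω x} => (PiS n M *ᵥ u) a) ≤ nsq (PiS n M *ᵥ u) :=
          sum_subtype_le_sum n M Ω (F := fun x => ‖(PiS n M *ᵥ u) x‖ ^ 2) (fun x => by positivity)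
      _ ≤ nsq u := nsq_PiS_mulVec_le n M u
      _ ≤ ((gammaPs d a')⁻¹) ^ 2 * nsq f := nsq_solExt_le n M a' Ω ha' f
  have := nsq_nonneg f
  nlinarith [hP, sq_nonneg a', mul_nonneg (sq_nonneg a') (mul_nonneg (sq_nonneg ((gammaPs d a')⁻¹)) this)]

end OneLevel

/-! ## §2 Two levels: the refined region, the compressed planting, and the defect identity -/

section TwoLevel

variable (N R : ℕ) [NeZero N] [NeZero R] (M : Fin d → ℕ) [hM : ∀ μ, NeZero (M μ)] (a' : ℝ)
  (Ω : Tor (fine N M) → Prop) [DecidablePred Ω]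

/-- [shape] the REFINED region `Ω′ = par⁻¹(Ω)`: a fine site is inside iff its block parent is. [folklore] -/
def refineR : Tor (fine (R * N) M) → Prop := fun x => Ω (par N R M x)

/-- membership in the refined region is decidable. [folklore] -/
instance decRefineR : DecidablePred (refineR N R M Ω) := fun x => inferInstanceAs (Decidable (Ω (par N R M x)))

/-- the COMPRESSED planting `J^Ω = (J₀)_{Ω′Ω}`. [folklore] -/
def JOm : Matrix {x // refineR N R M Ω x} {y // Ω y} ℂ := (JK0 N R M).toBlock (refineR N R M Ω) Ω

omit [NeZero N] [NeZero R] hM [DecidablePred Ω] in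
/-- King's planting couples a fine site only to its parent: `J₀(x, y) = 0` unless `par x = y`. [folklore] -/
theorem JK0_apply_eq_zero {x : Tor (fine (R * N) M)} {y : Tor (fine N M)} (h : par N R M x ≠ y) : JK0 N R M x y = 0 := by
  rw [JK0, Matrix.smul_apply, Matrix.conjTranspose_apply, star_Qavg0_apply, Qavg0, if_neg h, smul_zero]

omit [NeZero N] [NeZero R] hM [DecidablePred Ω] in
/-- `J₀` does not couple `Ω′`-rows to `¬Ω`-columns … [folklore] -/
theorem JK0_vanish_left : ∀ (x : Tor (fine (R * N) M)) (y : Tor (fine N M)), refineR N R M Ω x → ¬ Ω y → JK0 N R M x y = 0 :=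
  fun _ _ hx hy => JK0_apply_eq_zero N R M (fun h => hy (h ▸ hx))

omit [NeZero N] [NeZero R] hM [DecidablePred Ω] in
/-- … nor `¬Ω′`-rows to `Ω`-columns. [folklore] -/
theorem JK0_vanish_right : ∀ (x : Tor (fine (R * N) M)) (y : Tor (fine N M)), ¬ refineR N R M Ω x → Ω y → JK0 N R M x y = 0 :=
  fun x _ hx hy => JK0_apply_eq_zero N R M (fun h => hx (show Ω (par N R M x) by rw [h]; exact hy))

omit [NeZero R] in
/-- compression is multiplicative on `J₀·X`. [folklore] -/
theorem toBlock_JK0_mul (X : Matrix (Tor (fine N M)) (Tor (fine N M)) ℂ) :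
    (JK0 N R M * X).toBlock (refineR N R M Ω) Ω = JOm N R M Ω * X.toBlock Ω Ω :=
  toBlock_mul_of_vanish_left (refineR N R M Ω) Ω Ω _ _ (JK0_vanish_left N R M Ω)

/-- compression is multiplicative on `Y·J₀`. [folklore] -/
theorem toBlock_mul_JK0 (Y : Matrix (Tor (fine (R * N) M)) (Tor (fine (R * N) M)) ℂ) :
    (Y * JK0 N R M).toBlock (refineR N R M Ω) Ω = Y.toBlock (refineR N R M Ω) (refineR N R M Ω) * JOm N R M Ω :=
  toBlock_mul_of_vanish_right (refineR N R M Ω) (refineR N R M Ω) Ω _ _ (JK0_vanish_right N R M Ω)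

omit [DecidablePred Ω] in
/-- **the unit-block mass terms intertwine EXACTLY**: `J₀Δ′_N − Δ′_{RN}J₀ = J₀Δ_N − Δ_{RN}J₀` (`Π′_{RN}J₀ = J₀Π′_N`). [folklore] -/
theorem JK0_mul_DeltaPs_sub :
    JK0 N R M * DeltaPs N M a' - DeltaPs (R * N) M a' * JK0 N R M
      = JK0 N R M * LapS (fine N M) (N : ℂ) - LapS (fine (R * N) M) ((R * N : ℕ) : ℂ) * JK0 N R M := by
  rw [DeltaPs, DeltaPs, Matrix.mul_add, Matrix.add_mul, Matrix.mul_smul, Matrix.smul_mul, PiS_mul_JK0]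
  abel

/-- **THE COMPRESSED DEFECT IDENTITY**: `(D′^{Ω′})⁻¹·J^Ω − J^Ω·(D^Ω)⁻¹ = (D′^{Ω′})⁻¹·(J₀Δ_N − Δ_{RN}J₀)_{Ω′Ω}·(D^Ω)⁻¹`. [folklore] -/
theorem defect_eq (ha' : 0 < a') :
    (DOm (R * N) M a' (refineR N R M Ω))⁻¹ * JOm N R M Ω - JOm N R M Ω * (DOm N M a' Ω)⁻¹
      = (DOm (R * N) M a' (refineR N R M Ω))⁻¹
          * ((JK0 N R M * LapS (fine N M) (N : ℂ) - LapS (fine (R * N) M) ((R * N : ℕ) : ℂ) * JK0 N R M).toBlock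
              (refineR N R M Ω) Ω)
          * (DOm N M a' Ω)⁻¹ := by
  set G' := (DOm (R * N) M a' (refineR N R M Ω))⁻¹ with hG'
  set G := (DOm N M a' Ω)⁻¹ with hG
  have h1 : (JK0 N R M * LapS (fine N M) (N : ℂ) - LapS (fine (R * N) M) ((R * N : ℕ) : ℂ) * JK0 N R M).toBlock
        (refineR N R M Ω) Ω = JOm N R M Ω * DOm N M a' Ω - DOm (R * N) M a' (refineR N R M Ω) * JOm N R M Ω := by
    rw [← JK0_mul_DeltaPs_sub, toBlock_sub, toBlock_JK0_mul, toBlock_mul_JK0]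
    rfl
  have e1 : G' * (JOm N R M Ω * DOm N M a' Ω) * G = G' * JOm N R M Ω := by
    rw [Matrix.mul_assoc, Matrix.mul_assoc, hG, Matrix.mul_nonsing_inv _ (isUnit_det_DOm N M a' Ω ha'), Matrix.mul_one]
  have e2 : G' * (DOm (R * N) M a' (refineR N R M Ω) * JOm N R M Ω) * G = JOm N R M Ω * G := by
    rw [← Matrix.mul_assoc, hG', Matrix.nonsing_inv_mul _ (isUnit_det_DOm (R * N) M a' (refineR N R M Ω) ha'),
      Matrix.one_mul]
  rw [h1, Matrix.mul_sub, Matrix.sub_mul, e1, e2]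

omit [NeZero N] [NeZero R] hM [DecidablePred Ω] in
/-- a RECTANGULAR compression acts as «extend by zero, apply, restrict». [folklore] -/
theorem toBlock_mulVec' {m k : Type*} [Fintype m] [Fintype k] (p : m → Prop) (q : k → Prop) [DecidablePred p] [DecidablePred q]
    (X : Matrix m k ℂ) (w : {a // q a} → ℂ) :
    X.toBlock p q *ᵥ w = fun a : {a // p a} => (X *ᵥ ext q w) a := by
  funext a
  simp only [Matrix.mulVec, dotProduct, Matrix.toBlock_apply]
  rw [← Fintype.sum_subtype_add_sum_subtype q (fun i => X a i * ext q w i)]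
  have h2 : ∑ i : {i // ¬ q i}, X a i * ext q w i = 0 :=
    Finset.sum_eq_zero fun i _ => by rw [ext_apply_of_not q w i.2, mul_zero]
  rw [h2, add_zero]
  exact Finset.sum_congr rfl fun b _ => by rw [ext_apply_of]

/-- **THE PAIRING FORM OF THE DEFECT**: `⟨w, ((D′^{Ω′})⁻¹J^Ω − J^Ω(D^Ω)⁻¹)f⟩ = ⟨u′_w, (J₀Δ_N − Δ_{RN}J₀)u_f⟩` with the two zero-extended
Dirichlet solutions `u_f = solExt_N f ⊂ Ω`, `u′_w = solExt_{RN} w ⊂ Ω′`. [folklore] -/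
theorem form_defect (ha' : 0 < a') (w : {x // refineR N R M Ω x} → ℂ) (f : {y // Ω y} → ℂ) :
    star w ⬝ᵥ (((DOm (R * N) M a' (refineR N R M Ω))⁻¹ * JOm N R M Ω - JOm N R M Ω * (DOm N M a' Ω)⁻¹) *ᵥ f)
      = star (solExt (R * N) M a' (refineR N R M Ω) w)
          ⬝ᵥ ((JK0 N R M * LapS (fine N M) (N : ℂ) - LapS (fine (R * N) M) ((R * N : ℕ) : ℂ) * JK0 N R M)
              *ᵥ solExt N M a' Ω f) := by
  rw [defect_eq N R M a' Ω ha', ← Matrix.mulVec_mulVec, ← Matrix.mulVec_mulVec,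
    dotProduct_mulVec_eq_star_conjTranspose_mulVec, (inv_DOm_isHermitian (R * N) M a' (refineR N R M Ω)).eq,
    toBlock_mulVec', solExt, solExt, star_ext_dotProduct]

end TwoLevel

/-! ## §3 Operator norm from pairings -/

/-- an operator-norm bound from a bound on all pairings. [folklore] -/
theorem opNorm_le_of_pairing {α β : Type*} [Fintype α] [DecidableEq α] [Fintype β] [DecidableEq β] (X : Matrix α β ℂ) {C : ℝ}
    (hC : 0 ≤ C) (h : ∀ (w : α → ℂ) (f : β → ℂ), ‖star w ⬝ᵥ (X *ᵥ f)‖ ≤ C * Real.sqrt (nsq w) * Real.sqrt (nsq f)) :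
    ‖X‖ ≤ C := by
  refine opNorm_le_of_nsq_le_rect X hC fun f => ?_
  have h1 := h (X *ᵥ f) f
  rw [star_dotProduct_self, Complex.norm_real, Real.norm_of_nonneg (nsq_nonneg _)] at h1
  -- `s² ≤ C s t` with `s = √nsq(Xf)`, `t = √nsq f`
  have hs : Real.sqrt (nsq (X *ᵥ f)) ^ 2 = nsq (X *ᵥ f) := Real.sq_sqrt (nsq_nonneg _)
  have ht : Real.sqrt (nsq f) ^ 2 = nsq f := Real.sq_sqrt (nsq_nonneg _)
  have hs0 : 0 ≤ Real.sqrt (nsq (X *ᵥ f)) := Real.sqrt_nonneg _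
  have ht0 : 0 ≤ Real.sqrt (nsq f) := Real.sqrt_nonneg _
  rcases hs0.eq_or_lt with hz | hpos
  · rw [← hs, ← hz, zero_pow two_ne_zero]
    exact mul_nonneg (sq_nonneg C) (nsq_nonneg f)
  · have h2 : Real.sqrt (nsq (X *ᵥ f)) ≤ C * Real.sqrt (nsq f) := by
      have h3 : Real.sqrt (nsq (X *ᵥ f)) * Real.sqrt (nsq (X *ᵥ f)) ≤ (C * Real.sqrt (nsq f)) * Real.sqrt (nsq (X *ᵥ f)) := by
        rw [← pow_two, hs]; linarith [h1]
      exact le_of_mul_le_mul_right h3 hpos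
    calc nsq (X *ᵥ f) = Real.sqrt (nsq (X *ᵥ f)) ^ 2 := hs.symm
      _ ≤ (C * Real.sqrt (nsq f)) ^ 2 := pow_le_pow_left₀ hs0 h2 2
      _ = C ^ 2 * nsq f := by rw [mul_pow, ht]

end Summit.QuantumFields.BalabanUV.Beta.GAN24.DirichletBoxCompression

end
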